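import Literature.NumberTheory.GaloisRepresentations.UnramifiedRadicalDescentAbsolute
import Literature.NumberTheory.GaloisRepresentations.ArtinRestriction
import HarnessLib

/-!
# Radical descent at a finite level `F = K̄^H ⊆ K_S` of the tower (open `H ⊇ N_S`)

Topic `NumberTheory/GaloisRepresentations`; namespace `Literature.NumberTheory.GaloisRepresentations`.
Everything here is **proved** (no definition, no named fact, no instance; D-0026).  Third file of the
radical-descent group (`UnramifiedRadicalDescent`, `UnramifiedRadicalDescentAbsolute`): the (RD)
hypothesis of the tree's theorem "the kernel of `inf : H²(Gal(K_S/F), μ_N) → H²(Gal(K̄/F), μ_N)`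
dies under `μ_N ↪ μ_{N'}`" (`RestrictedRamificationInflationKernel`,
`cohomologyMap_twoCocycleClass_eq_zero_of_radicalDescent_of_kummer`, binder `hRD`) is DISCHARGED
for every OPEN subgroup `H ≤ Γ_K` containing `N_S` and `S ⊇ {v ∣ p}`, at `N = p^m`, `e = p^t`,
`N' = p^{m+t}`:

* `exists_pow_eq_mul_pow_of_smul_invariant_of_isOpen` (elements) / **`radicalDescent_of_isOpen`**
  (units, the shape of `hRD` token for token): there is `t` (`= v_p(#Cl(𝓞_{K̄^H}))`) such that every
  `b ∈ K̄ˣ` fixed by `N_S` with `σ b ∈ b · ((K̄^{N_S})ˣ)^{p^m}` for all `σ ∈ H` satisfies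
  `b^{p^t} = c · d^{p^{m+t}}` with `c` `H`-fixed and `d` `N_S`-fixed;
* `smul_eq_self_of_mem_ramificationSubgroup_of_forall_inertia` — an element fixed by every inertia
  group outside `S` is fixed by `N_S`.

Proof: `F = K̄^H` is a number field (Krull); a finite Galois hull `L ⊆ K_S` over `K` of `F`, `b`, the
radicals `d_σ` and `ζ_{p^{m+t}}` is Galois over `F` and unramified over `F` outside `S`
(`IsUnramifiedAt.of_restrictScalars` from `isUnramifiedIn_of_ramificationSubgroup_le_galFixing`); the
finite-level descent `exists_dvd_log_valuation_pow_mul_of_galois_invariant` over the BASE `F` gives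
`c ∈ Fˣ` with `p^{m+t} ∣ ord_w(b^{#Cl(𝓞_F)} c)` off `S`; a `p^{m+t}`-th root of `b^{#Cl} c` is
inertia-fixed off `S` (`smul_root_eq_of_mem_inertia_of_dvd`), hence `N_S`-fixed; the factor of
`#Cl(𝓞_F)` prime to `p` is absorbed by a Bézout identity since `b` is itself an `N_S`-fixed radical.  This is the
`Cl_S(F)/p^m`-term of Neukirch–Schmidt–Wingberg (8.3.11) (proof) at the finite level `F`, class
field theory free — the restricted-ramification input of Iwasawa's theorem NSW (10.3.25).

## References

* J. Neukirch, A. Schmidt, K. Wingberg, *Cohomology of Number Fields* (2008), (8.3.11), (10.3.25). [NeukirchSchmidtWingberg2008]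

## Mathlib / tree search

Tree: `finiteDimensional_fixedField_of_isOpen`, `fixingSubgroup_fixedField_of_isOpen`, `resGal`,
`coe_resGal_apply`, `exists_isGalois_subset_ramificationSubgroup_le_galFixing`,
`isUnramifiedIn_of_ramificationSubgroup_le_galFixing`, `exists_dvd_log_valuation_pow_mul_of_galois_invariant`,
`smul_root_eq_of_mem_inertia_of_dvd`.  Mathlib: `Module.finBasis`, `IntermediateField.inclusion`,
`IsGalois.tower_top_of_isGalois`, `Algebra.IsUnramifiedAt.of_restrictScalars`, `Nat.isCoprime_iff_coprime`,
`Units.coe_smul`.  `lean search 'radicalDescent|smul_invariant_of_isOpen'`: only the consumer binder `hRD`.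
-/

noncomputable section

open scoped NumberField nonZeroDivisors IntermediateField
open NumberField IsDedekindDomain IsDedekindDomain.HeightOneSpectrum Field WithZero IntermediateField
open Literature.NumberTheory.GaloisRepresentations.LocalWeilDatum

universe u

namespace Literature.NumberTheory.GaloisRepresentations

variable (K : Type u) [Field K] [NumberField K]

/-- Absorbing an exponent prime to `p`: if `b^{p^e h'} = c · α^{p^{m+e}}` with `p ∤ h'` in a field,
then `b^{p^e} = c^u · (α^u b^{p^e v})^{p^{m+e}}` for Bézout coefficients `u h' + v p^{m+e} = 1`.
[folklore] -/
private theorem exists_pow_prime_pow_eq_of_coprime {Ω : Type*} [Field Ω] {p e h' m : ℕ}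
    (hp : p.Prime) (hh' : ¬ p ∣ h') {b c α : Ω} (hb : b ≠ 0)
    (h : b ^ (p ^ e * h') = c * α ^ p ^ (m + e)) :
    ∃ u v : ℤ, b ^ p ^ e = c ^ u * (α ^ u * b ^ ((p : ℤ) ^ e * v)) ^ p ^ (m + e) := by
  have hcopN : Nat.Coprime h' (p ^ (m + e)) :=
    (Nat.Coprime.pow_right _ ((Nat.Prime.coprime_iff_not_dvd hp).mpr hh').symm)
  have hcop : IsCoprime (h' : ℤ) ((p : ℤ) ^ (m + e)) := by
    have h1 := Nat.isCoprime_iff_coprime.mpr hcopN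
    push_cast at h1
    exact h1
  obtain ⟨u, v, huv⟩ := hcop
  refine ⟨u, v, ?_⟩
  have e0 : b ^ p ^ e = b ^ ((p : ℤ) ^ e) := by rw [← zpow_natCast, Nat.cast_pow]
  have e1 : b ^ ((p : ℤ) ^ e) =
      (b ^ ((p : ℤ) ^ e * h')) ^ u * (b ^ ((p : ℤ) ^ e * v)) ^ ((p : ℤ) ^ (m + e)) := by
    rw [← zpow_mul, ← zpow_mul, ← zpow_add₀ hb]
    congr 1
    linear_combination (-(p : ℤ) ^ e) * huv
  have e2 : b ^ ((p : ℤ) ^ e * h') = b ^ (p ^ e * h') := by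
    rw [← zpow_natCast, Nat.cast_mul, Nat.cast_pow]
  have e3 : ∀ x : Ω, x ^ ((p : ℤ) ^ (m + e)) = x ^ p ^ (m + e) := fun x => by
    rw [← zpow_natCast, Nat.cast_pow]
  have e4 : (α ^ p ^ (m + e)) ^ u = (α ^ u) ^ p ^ (m + e) := by
    rw [← zpow_natCast, ← zpow_mul, ← zpow_natCast, ← zpow_mul, mul_comm]
  rw [e0, e1, e2, h, e3, mul_zpow, e4, mul_pow, mul_assoc]

omit [NumberField K] in
/-- **An element of `K̄` fixed by every inertia group outside `S` is fixed by `N_S`** (`N_S` is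
contained in the closed subgroup `Gal(K̄/K(x))`, `ramificationSubgroup_le_of_inertia_le`).
[cite: NeukirchSchmidtWingberg2008, VIII §3] -/
theorem smul_eq_self_of_mem_ramificationSubgroup_of_forall_inertia
    {S : Set (HeightOneSpectrum (𝓞 K))} {x : AlgebraicClosure K}
    (hx : ∀ v ∉ S, ∀ 𝔓 ∈ v.primesAbove, ∀ σ ∈ 𝔓.inertia (absoluteGaloisGroup K), σ • x = x)
    {g : absoluteGaloisGroup K} (hg : g ∈ ramificationSubgroup K S) : g • x = x := by
  have hle : ramificationSubgroup K S ≤ galFixing K K⟮x⟯ :=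
    ramificationSubgroup_le_of_inertia_le K (isClosed_galFixing K K⟮x⟯) fun v hv 𝔓 h𝔓 σ hσ =>
      (mem_galFixing_iff K).mpr fun y hy =>
        smul_eq_self_of_mem_adjoin K (S := {x}) (fun z hz => by
          rw [Set.mem_singleton_iff.mp hz]; exact hx v hv 𝔓 h𝔓 σ hσ) hy
  exact (mem_galFixing_iff K).mp (hle hg) x (mem_adjoin_simple_self K x)

/-- **Radical descent at a finite level of `K_S/K`** — the hypothesis (RD) of the tree's
"kernel of `inf : H²(G_S(F), μ_{p^m}) → H²(F, μ_{p^m})` dies under `μ_{p^m} ↪ μ_{p^{m+t}}`"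
(`RestrictedRamificationInflationKernel`, w6 g7), discharged for every OPEN subgroup `H ≤ Γ_K`
containing `N_S` (`F = K̄^H`, a number field inside `K_S`): if `b ∈ K_Sˣ` satisfies
`σ b ∈ b · (K_Sˣ)^{p^m}` for every `σ ∈ H`, then `b^{p^t} = c · d^{p^{m+t}}` for some `t`, some
`c ∈ Fˣ` (`H`-fixed, non-zero) and some `d ∈ K_S` (`N_S`-fixed); in fact `t = v_p(#Cl(𝓞_F))`.
Proof: `exists_dvd_log_valuation_pow_mul_of_galois_invariant` over the base `F` for a finite Galois
hull `L ⊆ K_S` of `F`, `b`, the radicals and `ζ_{p^{m+t}}`; a `p^{m+t}`-th root of `b^{#Cl} c` is fixed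
by every inertia group outside `S` (`smul_root_eq_of_mem_inertia_of_dvd`), hence lies in `K_S`; the
factor of `#Cl(𝓞_F)` prime to `p` is absorbed by a Bézout identity (`b` is itself a radical).
This is the `Cl_S(F)/p^m`-term of Neukirch–Schmidt–Wingberg (8.3.11) (proof) at the finite level
`F`, class-field-theory free. [cite: NeukirchSchmidtWingberg2008, VIII §3 (8.3.11) (proof)] -/
theorem exists_pow_eq_mul_pow_of_smul_invariant_of_isOpen {p : ℕ} [Fact p.Prime]
    {S : Set (HeightOneSpectrum (𝓞 K))}
    (hS : ∀ v : HeightOneSpectrum (𝓞 K), ((p : ℕ) : 𝓞 K) ∈ v.asIdeal → v ∈ S)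
    {H : Subgroup (absoluteGaloisGroup K)} (hHo : IsOpen (H : Set (absoluteGaloisGroup K)))
    (hNH : ramificationSubgroup K S ≤ H) (m : ℕ) :
    ∃ t : ℕ, ∀ b : AlgebraicClosure K, b ≠ 0 → (∀ g ∈ ramificationSubgroup K S, g • b = b) →
      (∀ σ ∈ H, ∃ γ : AlgebraicClosure K,
        (∀ g ∈ ramificationSubgroup K S, g • γ = γ) ∧ σ • b = b * γ ^ p ^ m) →
      ∃ c : AlgebraicClosure K, c ≠ 0 ∧ (∀ σ ∈ H, σ • c = c) ∧
        ∃ d : AlgebraicClosure K, (∀ g ∈ ramificationSubgroup K S, g • d = d) ∧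
          b ^ p ^ t = c * d ^ p ^ (m + t) := by
  classical
  have hp : p.Prime := Fact.out
  -- the finite level `F = K̄^H`
  set F : IntermediateField K (AlgebraicClosure K) := IntermediateField.fixedField H with hFdef
  haveI hFfin : FiniteDimensional K F := finiteDimensional_fixedField_of_isOpen H hHo
  haveI : NumberField F := NumberField.of_module_finite K F
  have hfix := fixingSubgroup_fixedField_of_isOpen H hHo
  have hHF : ∀ σ : absoluteGaloisGroup K, σ ∈ H ↔ ∀ x ∈ F, σ • x = x := by
    intro σ
    constructor
    · intro hσ x hx
      rw [hFdef, IntermediateField.mem_fixedField_iff] at hx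
      exact hx _ hσ
    · intro hσ
      have h1 : absoluteGaloisGroup.toAlgEquiv K σ ∈ F.fixingSubgroup :=
        (IntermediateField.mem_fixingSubgroup_iff _ _).mpr fun x hx => hσ x hx
      rw [hFdef, hfix] at h1
      exact h1
  set h : ℕ := Fintype.card (ClassGroup (𝓞 F)) with hh
  have hh0 : h ≠ 0 := Fintype.card_ne_zero
  set e : ℕ := h.factorization p with he
  set h' : ℕ := h / p ^ e with hh'
  have hdecomp : p ^ e * h' = h := Nat.ordProj_mul_ordCompl_eq_self h p
  have hndvd : ¬ p ∣ h' := Nat.not_dvd_ordCompl hp hh0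
  set d : ℕ := p ^ (m + e) with hd
  have hd0 : 0 < d := pow_pos hp.pos _
  have hdh : (d : ℤ) ∣ ((h * p ^ m : ℕ) : ℤ) := by
    refine Int.natCast_dvd_natCast.mpr ⟨h', ?_⟩
    rw [← hdecomp, hd, pow_add]
    ring
  haveI : NeZero ((d : ℕ) : AlgebraicClosure K) := ⟨Nat.cast_ne_zero.mpr hd0.ne'⟩
  obtain ⟨ζ, hζ⟩ := HasEnoughRootsOfUnity.exists_primitiveRoot (AlgebraicClosure K) d
  have hζN : ∀ g ∈ ramificationSubgroup K S, g • ζ = ζ := fun g hg =>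
    smul_eq_self_of_mem_ramificationSubgroup_of_pow_eq_one K hS (n := m + e) hζ.pow_eq_one hg
  refine ⟨e, fun b hb hbN hinv => ?_⟩
  -- stage 1: `L₀ ∋ b` finite Galois in `K_S`; lifts of `Gal(L₀/K)` chosen inside `H` when possible
  obtain ⟨L₀, hL₀fin, hL₀gal, hbL₀, -⟩ :=
    exists_isGalois_subset_ramificationSubgroup_le_galFixing K (S := S) (Set.finite_singleton b)
      (fun t ht g hg => by rw [Set.mem_singleton_iff.mp ht]; exact hbN g hg)
  haveI := hL₀fin
  haveI := hL₀gal
  have hbL₀' : b ∈ L₀ := hbL₀ (Set.mem_singleton b)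
  choose γ hγN hγb using hinv
  let lft : (L₀ ≃ₐ[K] L₀) → absoluteGaloisGroup K := fun τ =>
    if hτ : ∃ σ ∈ H, resGal L₀ σ = τ then hτ.choose else (resGal_surjective L₀ τ).choose
  have hlft : ∀ τ, resGal L₀ (lft τ) = τ := by
    intro τ
    by_cases hτ : ∃ σ ∈ H, resGal L₀ σ = τ
    · simp only [lft, dif_pos hτ]; exact hτ.choose_spec.2
    · simp only [lft, dif_neg hτ]; exact (resGal_surjective L₀ τ).choose_spec
  have hlftH : ∀ σ ∈ H, lft (resGal L₀ σ) ∈ H := by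
    intro σ hσ
    have hτ : ∃ σ' ∈ H, resGal L₀ σ' = resGal L₀ σ := ⟨σ, hσ, rfl⟩
    simp only [lft, dif_pos hτ]
    exact hτ.choose_spec.1
  let γ' : (L₀ ≃ₐ[K] L₀) → AlgebraicClosure K := fun τ =>
    if hτ : lft τ ∈ H then γ (lft τ) hτ else 1
  have hγ'N : ∀ τ, ∀ g ∈ ramificationSubgroup K S, g • γ' τ = γ' τ := by
    intro τ g hg
    by_cases hτ : lft τ ∈ H
    · simp only [γ', dif_pos hτ]; exact hγN _ hτ g hg
    · simp only [γ', dif_neg hτ, smul_one]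
  have hσb : ∀ σ ∈ H, σ • b = b * γ' (resGal L₀ σ) ^ p ^ m := by
    intro σ hσ
    have hmem := hlftH σ hσ
    simp only [γ', dif_pos hmem]
    rw [← hγb (lft (resGal L₀ σ)) hmem]
    have h1 := coe_resGal_apply L₀ σ ⟨b, hbL₀'⟩
    have h2 := coe_resGal_apply L₀ (lft (resGal L₀ σ)) ⟨b, hbL₀'⟩
    rw [hlft] at h2
    exact h1.symm.trans h2
  -- stage 2: the finite Galois hull `L ⊆ K_S` of `F`, `b`, `ζ` and the radicals, as an `F`-algebra
  set bF := Module.finBasis K F with hbFdef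
  set T : Set (AlgebraicClosure K) :=
    ({b, ζ} ∪ Set.range (fun τ : L₀ ≃ₐ[K] L₀ => γ' τ)) ∪
      Set.range (fun i => ((bF i : F) : AlgebraicClosure K)) with hT
  have hTfin : T.Finite :=
    (((Set.finite_singleton ζ).insert b).union (Set.finite_range _)).union (Set.finite_range _)
  have hTfix : ∀ t ∈ T, ∀ g ∈ ramificationSubgroup K S, g • t = t := by
    rintro t ((ht | ⟨τ, rfl⟩) | ⟨i, rfl⟩) g hg
    · rcases ht with rfl | ht
      · exact hbN g hg
      · rw [Set.mem_singleton_iff.mp ht]; exact hζN g hg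
    · exact hγ'N τ g hg
    · exact (hHF g).mp (hNH hg) _ (bF i).2
  obtain ⟨L, hLfin, hLgal, hTL, hLN⟩ :=
    exists_isGalois_subset_ramificationSubgroup_le_galFixing K hTfin hTfix
  haveI := hLfin
  haveI := hLgal
  haveI : NumberField L := NumberField.of_module_finite K L
  have hbL : b ∈ L := hTL (Or.inl (Or.inl (Or.inl rfl)))
  have hζL : ζ ∈ L := hTL (Or.inl (Or.inl (Or.inr rfl)))
  have hγL : ∀ τ : L₀ ≃ₐ[K] L₀, γ' τ ∈ L := fun τ => hTL (Or.inl (Or.inr ⟨τ, rfl⟩))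
  have hFL : F ≤ L := by
    intro x hx
    have hx' : (⟨x, hx⟩ : F) = ∑ i, bF.repr ⟨x, hx⟩ i • bF i := (bF.sum_repr ⟨x, hx⟩).symm
    have hx'' : x = ∑ i, bF.repr ⟨x, hx⟩ i • ((bF i : F) : AlgebraicClosure K) := by
      have := congrArg (fun y : F => (y : AlgebraicClosure K)) hx'
      simpa only [IntermediateField.coe_sum, IntermediateField.coe_smul] using this
    rw [hx'']
    exact L.sum_mem fun i _ => L.smul_mem (hTL (Or.inr ⟨i, rfl⟩))
  letI : Algebra F L := (IntermediateField.inclusion hFL).toRingHom.toAlgebra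
  have halgFL : ∀ x : F, ((algebraMap F L x : L) : AlgebraicClosure K) = (x : AlgebraicClosure K) :=
    fun x => rfl
  haveI : IsScalarTower K F L := IsScalarTower.of_algebraMap_eq fun x => Subtype.ext rfl
  haveI : IsGalois F L := IsGalois.tower_top_of_isGalois K F L
  haveI : IsScalarTower (𝓞 K) (𝓞 F) (𝓞 L) := IsScalarTower.of_algebraMap_eq fun x =>
    RingOfIntegers.ext rfl
  set bL : L := ⟨b, hbL⟩ with hbLdef
  have hbL0 : bL ≠ 0 := fun h0 => hb (congrArg Subtype.val h0)
  have hγτ : ∀ τ : L ≃ₐ[F] L, ∃ γ'' : L, τ bL = bL * γ'' ^ p ^ m := by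
    intro τ
    obtain ⟨σ, hσ⟩ := resGal_surjective L (τ.restrictScalars K)
    have hσH : σ ∈ H := by
      rw [hHF]
      intro x hx
      have h1 := coe_resGal_apply L σ ⟨x, hFL hx⟩
      rw [hσ] at h1
      rw [← h1]
      change ((τ (algebraMap F L ⟨x, hx⟩) : L) : AlgebraicClosure K) = x
      rw [AlgEquiv.commutes]
      rfl
    refine ⟨⟨γ' (resGal L₀ σ), hγL _⟩, Subtype.ext ?_⟩
    have h1 := coe_resGal_apply L σ bL
    rw [hσ] at h1
    change ((τ bL : L) : AlgebraicClosure K) = b * γ' (resGal L₀ σ) ^ p ^ m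
    rw [← hσb σ hσH, ← h1]
    rfl
  set SF : Set (HeightOneSpectrum (𝓞 F)) := {w | w.under (𝓞 K) ∈ S} with hSF
  have hunrK : ∀ v : HeightOneSpectrum (𝓞 K), v ∉ S → Algebra.IsUnramifiedIn (𝓞 L) v.asIdeal :=
    fun v hv => isUnramifiedIn_of_ramificationSubgroup_le_galFixing K L hLN hv
  have hunr : ∀ w : HeightOneSpectrum (𝓞 F), w ∉ SF → Algebra.IsUnramifiedIn (𝓞 L) w.asIdeal := by
    intro w hw P hP hPw
    haveI := hP
    haveI := hPw
    haveI : P.LiesOver (w.under (𝓞 K)).asIdeal := by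
      rw [IsDedekindDomain.HeightOneSpectrum.under_asIdeal]
      haveI : w.asIdeal.LiesOver (w.asIdeal.under (𝓞 K)) := ⟨rfl⟩
      exact Ideal.LiesOver.trans P w.asIdeal (w.asIdeal.under (𝓞 K))
    haveI : Algebra.IsUnramifiedAt (𝓞 K) P := hunrK (w.under (𝓞 K)) hw P hP inferInstance
    exact Algebra.IsUnramifiedAt.of_restrictScalars (𝓞 K) P
  obtain ⟨c, hc0, hc⟩ := exists_dvd_log_valuation_pow_mul_of_galois_invariant SF hunr
    (pow_pos hp.pos m) hbL0 hγτ
  set u : L := bL ^ h * algebraMap F L c with hudef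
  have hu0 : u ≠ 0 := mul_ne_zero (pow_ne_zero _ hbL0) ((map_ne_zero _).mpr hc0)
  obtain ⟨α, hα⟩ := IsAlgClosed.exists_pow_nat_eq ((u : L) : AlgebraicClosure K) hd0
  have hα' : α ^ d = algebraMap L (AlgebraicClosure K) u := hα
  set ζL : L := ⟨ζ, hζL⟩ with hζLdef
  have hζL' : IsPrimitiveRoot ζL d :=
    IsPrimitiveRoot.of_map_of_injective (f := algebraMap L (AlgebraicClosure K))
      (by exact hζ) (algebraMap L (AlgebraicClosure K)).injective
  -- `α` is fixed by every inertia group outside `S`, hence by `N_S`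
  have hαN : ∀ g ∈ ramificationSubgroup K S, g • α = α := by
    intro g hg
    refine smul_eq_self_of_mem_ramificationSubgroup_of_forall_inertia K (fun v hv 𝔓 h𝔓 σ hσ => ?_) hg
    haveI : 𝔓.IsPrime := h𝔓.1
    have hσL : σ ∈ galFixing K L := hLN (inertia_le_ramificationSubgroup hv h𝔓 hσ)
    let σL : AlgebraicClosure K ≃ₐ[L] AlgebraicClosure K :=
      { absoluteGaloisGroup.toAlgEquiv K σ with
        commutes' := fun x => (mem_galFixing_iff K).mp hσL x x.2 }
    have hσLapply : ∀ x : AlgebraicClosure K, σL x = σ • x := fun x => rfl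
    let ι : integralClosure (𝓞 L) (AlgebraicClosure K) →+* absIntegers (𝓞 K) K :=
      (integralClosure (𝓞 L) (AlgebraicClosure K)).val.toRingHom.codRestrict (absIntegers (𝓞 K) K)
        fun x => by
          rw [mem_integralClosure_iff]
          exact (isIntegral_trans (R := ℤ) (A := 𝓞 L) (x : AlgebraicClosure K) x.2).tower_top
    set 𝔓' : Ideal (integralClosure (𝓞 L) (AlgebraicClosure K)) := 𝔓.comap ι with h𝔓'def
    haveI h𝔓'prime : 𝔓'.IsPrime := Ideal.comap_isPrime ι 𝔓
    set W : Ideal (𝓞 L) := 𝔓'.under (𝓞 L) with hWdef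
    have hWv : W.under (𝓞 K) = v.asIdeal := by
      ext x
      rw [Ideal.under, Ideal.mem_comap, hWdef, Ideal.under, Ideal.mem_comap, h𝔓'def,
        Ideal.mem_comap, h𝔓.2.over, Ideal.under, Ideal.mem_comap]
      exact Iff.rfl
    have hW0 : W ≠ ⊥ := fun h0 => v.ne_bot (by
      rw [← hWv, h0]
      exact Ideal.comap_bot_of_injective _ (FaithfulSMul.algebraMap_injective (𝓞 K) (𝓞 L)))
    let w : HeightOneSpectrum (𝓞 L) := ⟨W, Ideal.IsPrime.under (𝓞 L) 𝔓', hW0⟩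
    haveI : 𝔓'.LiesOver w.asIdeal := ⟨rfl⟩
    have hwv : w.under (𝓞 K) = v := HeightOneSpectrum.ext hWv
    have hwS : w.under (𝓞 F) ∉ SF := by
      intro hmem
      apply hv
      rw [hSF, Set.mem_setOf_eq] at hmem
      have h2 : (w.under (𝓞 F)).under (𝓞 K) = w.under (𝓞 K) :=
        HeightOneSpectrum.ext (Ideal.under_under (A := 𝓞 K) (B := 𝓞 F) w.asIdeal)
      rwa [h2, hwv] at hmem
    have hpv : ((p : ℕ) : 𝓞 K) ∉ v.asIdeal := fun hpv => hv (hS v hpv)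
    have hdw : ((d : ℕ) : 𝓞 L) ∉ w.asIdeal := by
      intro hdw
      apply hpv
      rw [hd, Nat.cast_pow] at hdw
      have h1 : ((p : ℕ) : 𝓞 L) ∈ w.asIdeal := w.isPrime.mem_of_pow_mem _ hdw
      rw [← hwv]
      change algebraMap (𝓞 K) (𝓞 L) (p : 𝓞 K) ∈ w.asIdeal
      rwa [map_natCast]
    have hdvd : (d : ℤ) ∣ log (w.valuation L u) := hdh.trans (hc w hwS)
    have hσ' : σL ∈ 𝔓'.inertia (AlgebraicClosure K ≃ₐ[L] AlgebraicClosure K) := by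
      rw [Ideal.inertia, AddSubgroup.mem_inertia]
      intro x
      change ι (σL • x - x) ∈ 𝔓
      rw [map_sub]
      have hx : ι (σL • x) = σ • ι x := Subtype.ext (by
        change ((σL • x : integralClosure (𝓞 L) (AlgebraicClosure K)) : AlgebraicClosure K) =
          σ • (x : AlgebraicClosure K)
        rw [integralClosure.coe_smul]
        rfl)
      rw [hx]
      rw [Ideal.inertia, AddSubgroup.mem_inertia] at hσ
      exact hσ (ι x)
    have key := smul_root_eq_of_mem_inertia_of_dvd hd0 hζL' hu0 w hdw hdvd hα' 𝔓' hσ'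
    rwa [hσLapply] at key
  have hu : algebraMap L (AlgebraicClosure K) u =
      b ^ h * ((c : F) : AlgebraicClosure K) := by
    rw [hudef, map_mul, map_pow]
    rfl
  have hcK0 : ((c : F) : AlgebraicClosure K) ≠ 0 := fun h0 => hc0 (Subtype.ext h0)
  have hα0 : α ≠ 0 := by
    intro h0
    rw [h0, zero_pow hd0.ne', eq_comm, map_eq_zero] at hα'
    exact hu0 hα'
  have hmain : b ^ (p ^ e * h') = ((c : F) : AlgebraicClosure K)⁻¹ * α ^ p ^ (m + e) := by
    rw [hdecomp, ← hd, hα', hu, mul_comm (b ^ h) _, inv_mul_cancel_left₀ hcK0]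
  obtain ⟨uu, vv, huv⟩ := exists_pow_prime_pow_eq_of_coprime hp hndvd hb hmain
  refine ⟨(((c : F) : AlgebraicClosure K)⁻¹) ^ uu, zpow_ne_zero _ (inv_ne_zero hcK0),
    fun σ hσ => ?_, α ^ uu * b ^ ((p : ℤ) ^ e * vv), fun g hg => ?_, huv⟩
  · rw [absoluteGaloisGroup.smul_def, map_zpow₀, map_inv₀, ← absoluteGaloisGroup.smul_def,
      (hHF σ).mp hσ _ c.2]
  · rw [absoluteGaloisGroup.smul_def, map_mul, map_zpow₀, map_zpow₀, ← absoluteGaloisGroup.smul_def,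
      ← absoluteGaloisGroup.smul_def, hαN g hg, hbN g hg]


/-- **(RD) for OPEN `H`, units form** — the radical-descent hypothesis `hRD` of
`cohomologyMap_twoCocycleClass_eq_zero_of_radicalDescent_of_kummer`
(`RestrictedRamificationInflationKernel`) at `N = p^m`, `e = p^t`, `N' = p^{m+t}`, DISCHARGED for
every open `H ≥ N_S` when `S ⊇ {v ∣ p}`: there is `t` (namely `v_p(#Cl(𝓞_{K̄^H}))`) such that every
`b ∈ K̄ˣ` fixed by `N_S` with `σ b ∈ b · ((K̄^{N_S})ˣ)^{p^m}` for all `σ ∈ H` satisfies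
`b^{p^t} = c · d^{p^{m+t}}` with `c` `H`-fixed and `d` `N_S`-fixed.
[cite: NeukirchSchmidtWingberg2008, VIII §3 (8.3.11) (proof)] -/
theorem radicalDescent_of_isOpen {p : ℕ} [Fact p.Prime] {S : Set (HeightOneSpectrum (𝓞 K))}
    (hS : ∀ v : HeightOneSpectrum (𝓞 K), ((p : ℕ) : 𝓞 K) ∈ v.asIdeal → v ∈ S)
    {H : Subgroup (absoluteGaloisGroup K)} (hHo : IsOpen (H : Set (absoluteGaloisGroup K)))
    (hNH : ramificationSubgroup K S ≤ H) (m : ℕ) :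
    ∃ t : ℕ, ∀ b : (AlgebraicClosure K)ˣ, (∀ n ∈ ramificationSubgroup K S, n • b = b) →
      (∀ σ ∈ H, ∃ d : (AlgebraicClosure K)ˣ,
        (∀ n ∈ ramificationSubgroup K S, n • d = d) ∧ σ • b = b * d ^ p ^ m) →
      ∃ c d : (AlgebraicClosure K)ˣ, (∀ σ ∈ H, σ • c = c) ∧
        (∀ n ∈ ramificationSubgroup K S, n • d = d) ∧ b ^ p ^ t = c * d ^ p ^ (m + t) := by
  obtain ⟨t, ht⟩ := exists_pow_eq_mul_pow_of_smul_invariant_of_isOpen K hS hHo hNH m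
  refine ⟨t, fun b hbN hinv => ?_⟩
  have hbN' : ∀ g ∈ ramificationSubgroup K S, g • (b : AlgebraicClosure K) = b := fun g hg => by
    rw [← Units.coe_smul, hbN g hg]
  have hinv' : ∀ σ ∈ H, ∃ γ : AlgebraicClosure K,
      (∀ g ∈ ramificationSubgroup K S, g • γ = γ) ∧
        σ • (b : AlgebraicClosure K) = b * γ ^ p ^ m := by
    intro σ hσ
    obtain ⟨d, hd, hσb⟩ := hinv σ hσ
    refine ⟨d, fun g hg => by rw [← Units.coe_smul, hd g hg], ?_⟩
    rw [← Units.coe_smul, hσb, Units.val_mul, Units.val_pow_eq_pow_val]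
  obtain ⟨c, hc0, hcH, d, hdN, hbe⟩ := ht b b.ne_zero hbN' hinv'
  have hd0 : d ≠ 0 := by
    intro h0
    rw [h0, zero_pow (pow_pos (Fact.out : p.Prime).pos _).ne', mul_zero] at hbe
    exact (pow_ne_zero _ b.ne_zero) hbe
  refine ⟨Units.mk0 c hc0, Units.mk0 d hd0, fun σ hσ => Units.ext ?_, fun n hn => Units.ext ?_,
    Units.ext ?_⟩
  · rw [Units.coe_smul, Units.val_mk0, hcH σ hσ]
  · rw [Units.coe_smul, Units.val_mk0, hdN n hn]
  · rw [Units.val_pow_eq_pow_val, Units.val_mul, Units.val_pow_eq_pow_val, Units.val_mk0,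
      Units.val_mk0, hbe]

end Literature.NumberTheory.GaloisRepresentations

end
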